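import Summits.BirchSwinnertonDyer.BirchSwinnertonDyer.Theorems.TwoAdicConverseGoodTwistsLeafOn
import Summits.BirchSwinnertonDyer.BirchSwinnertonDyer.Theorems.TwoAdicConverseOffHabitatResidualGlue
import Literature.NumberTheory.EllipticCurves.TwoAdicImageQuadraticTwistProofs
import HarnessLib

/-!
# Route TwoAdicConverse — the S3 head line OFF the big-image habitat: from KRR2's residual 24303
# alone, and per stratum from the stratum pieces (proofs only)

Cell `bsd-2adic`, seat `bsd-2adic-conv-1` GEN 18 (`--supports` item stmt-BirchSwinnertonDyer-19218; nothing
here closes it).  GEN 17 (p608652 `…GoodTwistsKolyvaginBigImageLeaf`) derived LADDER-BSD §1 row S3's head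
line — rank BSD for `100 %` of the good twists `d ∈ 𝓕` and Goldfeld's `50/50` with BSD — for every curve ON
the surjective-`2`-adic-image habitat from the Kolyvagin-at-`2` cruxes 24622 V1′ + 24623 V2♭ (+ 24405,
23951, BFH, GZK, Smith).  The habitat and its complement are unions of quadratic-twist classes
(`forall_hasSurjectiveModNGaloisRep_two_pow_quadraticTwist_iff`, p617152; model-independence
`hasSurjectiveModNGaloisRep_smul_iff`), and so are the strata (β) rational `2`-torsion, (γ₁) `C₃` image,
(γ₂) `ℚ(√Δ) = ℚ(i)` (§0).  Feeding the generic engine `bsdRank_and_goldfeld_goodTwists_of_leafOn`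
(p617988):

* `bsdRank_and_goldfeld_goodTwists_offHabitat_of_offHabitatNonSurjTwoConverse` — the head line for EVERY
  non-CM curve good-ordinary or multiplicative at `2` that is OFF the habitat, from KRR2's residual item
  24303 `KolyvaginRankRigidityAtTwo.OffHabitatNonSurjTwoConverse` ALONE (+ GZK, Modularity, Smith) — no
  Kolyvagin crux is needed there, mirroring planner RC-209's division of labour;
* `bsdRank_and_goldfeld_goodTwists_of_kolyvaginAtTwo_of_offHabitatNonSurjTwoConverse` — the head line
  for EVERY curve of the leaf's class from {24622, 24623} on the habitat and {24303} off it;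
* `…_twoTorsion_of_piece`, `…_c3Image_of_piece`, `…_qiImage_of_piece` — the head line for every curve
  of stratum (β) / (γ₁) / (γ₂) from the leaf restricted to THAT stratum (`r ≤ 1`), i.e. from the
  stratum's own typed pieces.

HONEST FRAMING.  Pure logic over the tree's counting machinery; 24303, V1′, V2♭ and the stratum pieces are
OPEN hypotheses; GZK, Modularity, BFH, 23951 and Smith's Thm 1.1 are the tree's named facts taken as
hypotheses; no item is filed (D-0014); nothing is booked (D-0054); BSD is not proved by any of this.
PARTITION: none — RANK axis (S3); companion cell X5@2 good-ord/mult, off-habitat complement.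

References: A. Smith, arXiv:2503.17619 Thm 1.1 / Cor 1.2 [arXiv250317619]; M. R. Murty, V. K. Murty (1997)
Ch. 6 §1 [MurtyMurty1997]; T. Dokchitser, V. Dokchitser, Math. Z. 272 (2012) [DokchitserDokchitserMathZ2012];
J. Rouse, D. Zureick-Brown, Res. Number Theory 1 (2015) Rem. 1.6 [RouseZureickbrown2015]; W. Zhang, Camb.
J. Math. 2 (2014) Thm 1.1 [WZhang2014].
-/

set_option linter.dupNamespace false
set_option autoImplicit false

noncomputable section

open scoped Classical
open Filter Topology WeierstrassCurve Literature Literature.NumberTheory.EllipticCurves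
  Literature.NumberTheory.EllipticCurves.ModularForms
  Literature.NumberTheory.EllipticCurves.Rank1Residual
  Summit.BirchSwinnertonDyer.BirchSwinnertonDyer.Theses
  Summit.BirchSwinnertonDyer.BirchSwinnertonDyer.Theses.TwoAdicConverse
  Summit.BirchSwinnertonDyer.BirchSwinnertonDyer.Theorems.GoldfeldGoodTwists
  Summit.BirchSwinnertonDyer.BirchSwinnertonDyer.Theorems.TwoAdicGoodTwists
  Summit.BirchSwinnertonDyer.BirchSwinnertonDyer.Theorems.TwoAdicKolyvaginGoodTwists

namespace Summit.BirchSwinnertonDyer.BirchSwinnertonDyer.Theorems.TwoAdicOffHabitat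

/-! ## §0 The complement and its strata are closed under «minimal model of a good twist» -/

/-- **Off the habitat stays off the habitat**: if `ρ_{V,2^∞}` is not onto and `C • V' = V^{(d)}`
(`d ≠ 0`), then `ρ_{V',2^∞}` is not onto (twist-invariance of the `2`-adic image, p617152, + model
independence). [cite: DokchitserDokchitserMathZ2012, Theorem (1)–(3)] [cite: RouseZureickbrown2015, Remark 1.6] -/
theorem offHabitat_of_smul_eq_quadraticTwist (V V' : WeierstrassCurve ℚ) [V.IsElliptic] {d : ℚ}
    (hd : d ≠ 0) {C : VariableChange ℚ} (hC : C • V' = V.quadraticTwist d)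
    (hoff : ¬ ∀ m : ℕ, V.HasSurjectiveModNGaloisRep ((2 ^ m : ℕ) : ℤ)) :
    ¬ ∀ m : ℕ, V'.HasSurjectiveModNGaloisRep ((2 ^ m : ℕ) : ℤ) := by
  intro hsur'
  apply hoff
  have h' : ∀ m : ℕ, (V.quadraticTwist d).HasSurjectiveModNGaloisRep ((2 ^ m : ℕ) : ℤ) := fun m ↦ by
    rw [← hC]
    exact (hasSurjectiveModNGaloisRep_smul_iff V' C _).mpr (hsur' m)
  exact (forall_hasSurjectiveModNGaloisRep_two_pow_quadraticTwist_iff V hd).mp h'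

/-- **Stratum (β) is closed under «minimal model of a twist»**: a rational point of order `2` on `V`
gives one on every `V'` with `C • V' = V^{(d)}` (`exists_two_torsion_quadraticTwist_iff` + `pointEquiv`).
[cite: SilvermanAEC2009, X.5 Cor. 5.4 and III.3.1(b)] -/
theorem twoTorsion_of_smul_eq_quadraticTwist (V V' : WeierstrassCurve ℚ) [V.IsElliptic] {d : ℚ}
    (hd : d ≠ 0) {C : VariableChange ℚ} (hC : C • V' = V.quadraticTwist d)
    (h : ∃ P : V.toAffine.Point, P ≠ 0 ∧ 2 • P = 0) :
    ∃ P : V'.toAffine.Point, P ≠ 0 ∧ 2 • P = 0 := by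
  have h1 := (exists_two_torsion_quadraticTwist_iff V hd).mpr h
  rw [← hC] at h1
  exact (exists_two_torsion_smul_iff V' C).mp h1

/-- **Stratum (γ₁) (`C₃` image: no rational `2`-torsion and `Δ ∈ ℚ^{×2}`) is closed under «minimal
model of a twist».** [cite: DokchitserDokchitserMathZ2012, Theorem (1)] [cite: SilvermanAEC2009, X.5 Cor. 5.4] -/
theorem c3Image_of_smul_eq_quadraticTwist (V V' : WeierstrassCurve ℚ) [V.IsElliptic] {d : ℚ}
    (hd : d ≠ 0) {C : VariableChange ℚ} (hC : C • V' = V.quadraticTwist d)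
    (h : (∀ P : V.toAffine.Point, 2 • P = 0 → P = 0) ∧ IsSquare V.Δ) :
    (∀ P : V'.toAffine.Point, 2 • P = 0 → P = 0) ∧ IsSquare V'.Δ := by
  have h1 := (c3Stratum_quadraticTwist_iff V hd).mpr h
  rw [← hC] at h1
  obtain ⟨hno, hsq⟩ := h1
  refine ⟨fun P h2P ↦ ?_, (isSquare_Δ_smul_iff V' C).mp hsq⟩
  by_contra hP0
  obtain ⟨Q, hQ0, h2Q⟩ := (exists_two_torsion_smul_iff V' C).mpr ⟨P, hP0, h2P⟩
  exact hQ0 (hno Q h2Q)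

/-- **Stratum (γ₂) (`ρ̄₂` onto and `-Δ ∈ ℚ^{×2}`) is closed under «minimal model of a twist».**
[cite: DokchitserDokchitserMathZ2012, Theorem (1)] [cite: RouseZureickbrown2015, Remark 1.6] -/
theorem qiImage_of_smul_eq_quadraticTwist (V V' : WeierstrassCurve ℚ) [V.IsElliptic] {d : ℚ}
    (hd : d ≠ 0) {C : VariableChange ℚ} (hC : C • V' = V.quadraticTwist d)
    (h : V.HasSurjectiveModNGaloisRep 2 ∧ IsSquare (-V.Δ)) :
    V'.HasSurjectiveModNGaloisRep 2 ∧ IsSquare (-V'.Δ) := by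
  have h1 := (qiStratum_quadraticTwist_iff V hd).mpr h
  rw [← hC] at h1
  exact ⟨(hasSurjectiveModNGaloisRep_smul_iff V' C 2).mp h1.1, (isSquare_neg_Δ_smul_iff V' C).mp h1.2⟩

/-! ## §1 The head line off the habitat from KRR2's residual 24303 alone -/

section OffHabitat

variable (W : WeierstrassCurve ℚ) [W.IsElliptic] [W.IsGloballyMinimal]

/-- **LADDER-BSD §1 row S3's head line for every OFF-habitat curve, from KRR2's residual 24303 ALONE.**
For every globally minimal NON-CM `W/ℚ` good-ordinary or multiplicative at `2` whose `2`-adic image is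
NOT onto: rank BSD for `100 %` of the good twists `d ∈ 𝓕` and Goldfeld's `50/50` with BSD in `𝓕`, from
item 24303 `KolyvaginRankRigidityAtTwo.OffHabitatNonSurjTwoConverse` + GZK + Modularity + Smith's Thm 1.1
for `W` — the complement's counterpart of `bsdRank_and_goldfeld_goodTwists_leafHabitat_of_kolyvaginAtTwo`.
[cite: arXiv250317619, Thm. 1.1 and Cor. 1.2] [cite: MurtyMurty1997, Ch. 6 §1] [cite: RouseZureickbrown2015, Remark 1.6] -/
theorem bsdRank_and_goldfeld_goodTwists_offHabitat_of_offHabitatNonSurjTwoConverse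
    (hR : KolyvaginRankRigidityAtTwo.OffHabitatNonSurjTwoConverse)
    (hGZK : rank_eq_analyticRank_of_analyticRank_le_one) (hmod : exists_isNewformOf)
    (hCM : ¬ W.HasCM) (hred : GoodOrd W 2 ∨ Mult W 2)
    (hoff : ¬ ∀ m : ℕ, W.HasSurjectiveModNGaloisRep ((2 ^ m : ℕ) : ℤ))
    (hS : smith_selmerCorank_density W) :
    Tendsto (fun X : ℕ ↦ (Nat.card {d : ℤ | Squarefree d ∧ |d| ≤ (X : ℤ) ∧ (d % 4 = 1 ∧
        ((W.quadraticTwist d).analyticRank = (W.quadraticTwist d).mordellWeilRank ∧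
          Finite (W.quadraticTwist d).sha))} : ℝ) /
      Nat.card {d : ℤ | Squarefree d ∧ |d| ≤ (X : ℤ) ∧ d % 4 = 1}) atTop (𝓝 1) ∧
    Tendsto (fun X : ℕ ↦ (Nat.card {d : ℤ | Squarefree d ∧ |d| ≤ (X : ℤ) ∧ (d % 4 = 1 ∧
        ((W.quadraticTwist d).analyticRank = 0 ∧ (W.quadraticTwist d).mordellWeilRank = 0 ∧
          Finite (W.quadraticTwist d).sha))} : ℝ) /
      Nat.card {d : ℤ | Squarefree d ∧ |d| ≤ (X : ℤ) ∧ d % 4 = 1}) atTop (𝓝 (1 / 2)) ∧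
    Tendsto (fun X : ℕ ↦ (Nat.card {d : ℤ | Squarefree d ∧ |d| ≤ (X : ℤ) ∧ (d % 4 = 1 ∧
        ((W.quadraticTwist d).analyticRank = 1 ∧ (W.quadraticTwist d).mordellWeilRank = 1 ∧
          Finite (W.quadraticTwist d).sha))} : ℝ) /
      Nat.card {d : ℤ | Squarefree d ∧ |d| ≤ (X : ℤ) ∧ d % 4 = 1}) atTop (𝓝 (1 / 2)) :=
  bsdRank_and_goldfeld_goodTwists_of_leafOn
    (fun V ↦ ¬ ∀ m : ℕ, V.HasSurjectiveModNGaloisRep ((2 ^ m : ℕ) : ℤ))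
    (fun V V' _ _ hd _ hC hV ↦ offHabitat_of_smul_eq_quadraticTwist V V' hd hC hV)
    (fun V _ _ hcm hred' hV r hr hc ↦ hR V hcm hred' r hr hc hV)
    hGZK W hmod hCM hred hoff hS

/-- **The head line for EVERY curve of the leaf's class, from {24622 V1′, 24623 V2♭} ON the habitat and
{24303} OFF it** (+ 24405, 23951, BFH, GZK, Smith): the two routes' division of labour made explicit —
on the habitat GEN 17's `bsdRank_and_goldfeld_goodTwists_leafHabitat_of_kolyvaginAtTwo`, off it the
previous theorem. [cite: arXiv250317619, Thm. 1.1 and Cor. 1.2] [cite: WZhang2014, Thm. 1.1 (shape at p ≥ 5)]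
[cite: MurtyMurty1997, Ch. 6 §1] -/
theorem bsdRank_and_goldfeld_goodTwists_of_kolyvaginAtTwo_of_offHabitatNonSurjTwoConverse
    (hV1 : KolyvaginNonvanishingAtTwoFrame) (hV2 : KolyvaginCorankLowerBoundAtTwo)
    (hT : NoTwoTorsionOverK) (hIn : TwoAdicConverse.PrintedInputsRankOneAtTwo)
    (hBFH : bumpFriedbergHoffstein_exists_heegnerField_split_twist_simpleZero)
    (hGZK : rank_eq_analyticRank_of_analyticRank_le_one)
    (hR : KolyvaginRankRigidityAtTwo.OffHabitatNonSurjTwoConverse)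
    (hCM : ¬ W.HasCM) (hred : GoodOrd W 2 ∨ Mult W 2) (hS : smith_selmerCorank_density W) :
    Tendsto (fun X : ℕ ↦ (Nat.card {d : ℤ | Squarefree d ∧ |d| ≤ (X : ℤ) ∧ (d % 4 = 1 ∧
        ((W.quadraticTwist d).analyticRank = (W.quadraticTwist d).mordellWeilRank ∧
          Finite (W.quadraticTwist d).sha))} : ℝ) /
      Nat.card {d : ℤ | Squarefree d ∧ |d| ≤ (X : ℤ) ∧ d % 4 = 1}) atTop (𝓝 1) ∧
    Tendsto (fun X : ℕ ↦ (Nat.card {d : ℤ | Squarefree d ∧ |d| ≤ (X : ℤ) ∧ (d % 4 = 1 ∧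
        ((W.quadraticTwist d).analyticRank = 0 ∧ (W.quadraticTwist d).mordellWeilRank = 0 ∧
          Finite (W.quadraticTwist d).sha))} : ℝ) /
      Nat.card {d : ℤ | Squarefree d ∧ |d| ≤ (X : ℤ) ∧ d % 4 = 1}) atTop (𝓝 (1 / 2)) ∧
    Tendsto (fun X : ℕ ↦ (Nat.card {d : ℤ | Squarefree d ∧ |d| ≤ (X : ℤ) ∧ (d % 4 = 1 ∧
        ((W.quadraticTwist d).analyticRank = 1 ∧ (W.quadraticTwist d).mordellWeilRank = 1 ∧
          Finite (W.quadraticTwist d).sha))} : ℝ) /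
      Nat.card {d : ℤ | Squarefree d ∧ |d| ≤ (X : ℤ) ∧ d % 4 = 1}) atTop (𝓝 (1 / 2)) := by
  by_cases hsur : ∀ m : ℕ, W.HasSurjectiveModNGaloisRep ((2 ^ m : ℕ) : ℤ)
  · exact bsdRank_and_goldfeld_goodTwists_leafHabitat_of_kolyvaginAtTwo W hV1 hV2 hT hIn hBFH hGZK hCM
      hred hsur hS
  · exact bsdRank_and_goldfeld_goodTwists_offHabitat_of_offHabitatNonSurjTwoConverse W hR hGZK hIn.1 hCM
      hred hsur hS

end OffHabitat

/-! ## §2 The head line on each stratum from the stratum's own pieces -/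

section Strata

variable (W : WeierstrassCurve ℚ) [W.IsElliptic] [W.IsGloballyMinimal]

/-- **The head line for every curve of stratum (β) (a rational point of order `2`), from the leaf
restricted to (β)** (`r ≤ 1`: the union of the typed `r = 0` piece `R0TwoTorsion…` and its `r = 1` twin)
+ GZK + Modularity + Smith. [cite: arXiv250317619, Thm. 1.1 and Cor. 1.2] [cite: MurtyMurty1997, Ch. 6 §1] -/
theorem bsdRank_and_goldfeld_goodTwists_twoTorsion_of_piece
    (hβ : ∀ (V : WeierstrassCurve ℚ) [V.IsElliptic] [V.IsGloballyMinimal], ¬ V.HasCM →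
      (GoodOrd V 2 ∨ Mult V 2) → (∃ P : V.toAffine.Point, P ≠ 0 ∧ 2 • P = 0) →
      ∀ r : ℕ, r ≤ 1 → V.selmerCorank 2 = r → V.analyticRank = r)
    (hGZK : rank_eq_analyticRank_of_analyticRank_le_one) (hmod : exists_isNewformOf)
    (hCM : ¬ W.HasCM) (hred : GoodOrd W 2 ∨ Mult W 2)
    (hW : ∃ P : W.toAffine.Point, P ≠ 0 ∧ 2 • P = 0) (hS : smith_selmerCorank_density W) :
    Tendsto (fun X : ℕ ↦ (Nat.card {d : ℤ | Squarefree d ∧ |d| ≤ (X : ℤ) ∧ (d % 4 = 1 ∧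
        ((W.quadraticTwist d).analyticRank = (W.quadraticTwist d).mordellWeilRank ∧
          Finite (W.quadraticTwist d).sha))} : ℝ) /
      Nat.card {d : ℤ | Squarefree d ∧ |d| ≤ (X : ℤ) ∧ d % 4 = 1}) atTop (𝓝 1) ∧
    Tendsto (fun X : ℕ ↦ (Nat.card {d : ℤ | Squarefree d ∧ |d| ≤ (X : ℤ) ∧ (d % 4 = 1 ∧
        ((W.quadraticTwist d).analyticRank = 0 ∧ (W.quadraticTwist d).mordellWeilRank = 0 ∧
          Finite (W.quadraticTwist d).sha))} : ℝ) /
      Nat.card {d : ℤ | Squarefree d ∧ |d| ≤ (X : ℤ) ∧ d % 4 = 1}) atTop (𝓝 (1 / 2)) ∧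
    Tendsto (fun X : ℕ ↦ (Nat.card {d : ℤ | Squarefree d ∧ |d| ≤ (X : ℤ) ∧ (d % 4 = 1 ∧
        ((W.quadraticTwist d).analyticRank = 1 ∧ (W.quadraticTwist d).mordellWeilRank = 1 ∧
          Finite (W.quadraticTwist d).sha))} : ℝ) /
      Nat.card {d : ℤ | Squarefree d ∧ |d| ≤ (X : ℤ) ∧ d % 4 = 1}) atTop (𝓝 (1 / 2)) :=
  bsdRank_and_goldfeld_goodTwists_of_leafOn
    (fun V ↦ ∃ P : V.toAffine.Point, P ≠ 0 ∧ 2 • P = 0)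
    (fun V V' _ _ hd _ hC hV ↦ twoTorsion_of_smul_eq_quadraticTwist V V' hd hC hV)
    (fun V _ _ hcm hred' hV r hr hc ↦ hβ V hcm hred' hV r hr hc)
    hGZK W hmod hCM hred hW hS

/-- **The head line for every curve of stratum (γ₁) (`C₃` image: no rational `2`-torsion, `Δ ∈ ℚ^{×2}`),
from the leaf restricted to (γ₁).** [cite: arXiv250317619, Thm. 1.1 and Cor. 1.2] [cite: MurtyMurty1997, Ch. 6 §1] -/
theorem bsdRank_and_goldfeld_goodTwists_c3Image_of_piece
    (hγ₁ : ∀ (V : WeierstrassCurve ℚ) [V.IsElliptic] [V.IsGloballyMinimal], ¬ V.HasCM →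
      (GoodOrd V 2 ∨ Mult V 2) → ((∀ P : V.toAffine.Point, 2 • P = 0 → P = 0) ∧ IsSquare V.Δ) →
      ∀ r : ℕ, r ≤ 1 → V.selmerCorank 2 = r → V.analyticRank = r)
    (hGZK : rank_eq_analyticRank_of_analyticRank_le_one) (hmod : exists_isNewformOf)
    (hCM : ¬ W.HasCM) (hred : GoodOrd W 2 ∨ Mult W 2)
    (hW : (∀ P : W.toAffine.Point, 2 • P = 0 → P = 0) ∧ IsSquare W.Δ) (hS : smith_selmerCorank_density W) :
    Tendsto (fun X : ℕ ↦ (Nat.card {d : ℤ | Squarefree d ∧ |d| ≤ (X : ℤ) ∧ (d % 4 = 1 ∧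
        ((W.quadraticTwist d).analyticRank = (W.quadraticTwist d).mordellWeilRank ∧
          Finite (W.quadraticTwist d).sha))} : ℝ) /
      Nat.card {d : ℤ | Squarefree d ∧ |d| ≤ (X : ℤ) ∧ d % 4 = 1}) atTop (𝓝 1) ∧
    Tendsto (fun X : ℕ ↦ (Nat.card {d : ℤ | Squarefree d ∧ |d| ≤ (X : ℤ) ∧ (d % 4 = 1 ∧
        ((W.quadraticTwist d).analyticRank = 0 ∧ (W.quadraticTwist d).mordellWeilRank = 0 ∧
          Finite (W.quadraticTwist d).sha))} : ℝ) /
      Nat.card {d : ℤ | Squarefree d ∧ |d| ≤ (X : ℤ) ∧ d % 4 = 1}) atTop (𝓝 (1 / 2)) ∧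
    Tendsto (fun X : ℕ ↦ (Nat.card {d : ℤ | Squarefree d ∧ |d| ≤ (X : ℤ) ∧ (d % 4 = 1 ∧
        ((W.quadraticTwist d).analyticRank = 1 ∧ (W.quadraticTwist d).mordellWeilRank = 1 ∧
          Finite (W.quadraticTwist d).sha))} : ℝ) /
      Nat.card {d : ℤ | Squarefree d ∧ |d| ≤ (X : ℤ) ∧ d % 4 = 1}) atTop (𝓝 (1 / 2)) :=
  bsdRank_and_goldfeld_goodTwists_of_leafOn
    (fun V ↦ (∀ P : V.toAffine.Point, 2 • P = 0 → P = 0) ∧ IsSquare V.Δ)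
    (fun V V' _ _ hd _ hC hV ↦ c3Image_of_smul_eq_quadraticTwist V V' hd hC hV)
    (fun V _ _ hcm hred' hV r hr hc ↦ hγ₁ V hcm hred' hV r hr hc)
    hGZK W hmod hCM hred hW hS

/-- **The head line for every curve of stratum (γ₂) (`ρ̄₂` onto, `ℚ(√Δ) = ℚ(i)`), from the leaf
restricted to (γ₂).** [cite: arXiv250317619, Thm. 1.1 and Cor. 1.2] [cite: MurtyMurty1997, Ch. 6 §1] -/
theorem bsdRank_and_goldfeld_goodTwists_qiImage_of_piece
    (hγ₂ : ∀ (V : WeierstrassCurve ℚ) [V.IsElliptic] [V.IsGloballyMinimal], ¬ V.HasCM →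
      (GoodOrd V 2 ∨ Mult V 2) → (V.HasSurjectiveModNGaloisRep 2 ∧ IsSquare (-V.Δ)) →
      ∀ r : ℕ, r ≤ 1 → V.selmerCorank 2 = r → V.analyticRank = r)
    (hGZK : rank_eq_analyticRank_of_analyticRank_le_one) (hmod : exists_isNewformOf)
    (hCM : ¬ W.HasCM) (hred : GoodOrd W 2 ∨ Mult W 2)
    (hW : W.HasSurjectiveModNGaloisRep 2 ∧ IsSquare (-W.Δ)) (hS : smith_selmerCorank_density W) :
    Tendsto (fun X : ℕ ↦ (Nat.card {d : ℤ | Squarefree d ∧ |d| ≤ (X : ℤ) ∧ (d % 4 = 1 ∧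
        ((W.quadraticTwist d).analyticRank = (W.quadraticTwist d).mordellWeilRank ∧
          Finite (W.quadraticTwist d).sha))} : ℝ) /
      Nat.card {d : ℤ | Squarefree d ∧ |d| ≤ (X : ℤ) ∧ d % 4 = 1}) atTop (𝓝 1) ∧
    Tendsto (fun X : ℕ ↦ (Nat.card {d : ℤ | Squarefree d ∧ |d| ≤ (X : ℤ) ∧ (d % 4 = 1 ∧
        ((W.quadraticTwist d).analyticRank = 0 ∧ (W.quadraticTwist d).mordellWeilRank = 0 ∧
          Finite (W.quadraticTwist d).sha))} : ℝ) /
      Nat.card {d : ℤ | Squarefree d ∧ |d| ≤ (X : ℤ) ∧ d % 4 = 1}) atTop (𝓝 (1 / 2)) ∧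
    Tendsto (fun X : ℕ ↦ (Nat.card {d : ℤ | Squarefree d ∧ |d| ≤ (X : ℤ) ∧ (d % 4 = 1 ∧
        ((W.quadraticTwist d).analyticRank = 1 ∧ (W.quadraticTwist d).mordellWeilRank = 1 ∧
          Finite (W.quadraticTwist d).sha))} : ℝ) /
      Nat.card {d : ℤ | Squarefree d ∧ |d| ≤ (X : ℤ) ∧ d % 4 = 1}) atTop (𝓝 (1 / 2)) :=
  bsdRank_and_goldfeld_goodTwists_of_leafOn
    (fun V ↦ V.HasSurjectiveModNGaloisRep 2 ∧ IsSquare (-V.Δ))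
    (fun V V' _ _ hd _ hC hV ↦ qiImage_of_smul_eq_quadraticTwist V V' hd hC hV)
    (fun V _ _ hcm hred' hV r hr hc ↦ hγ₂ V hcm hred' hV r hr hc)
    hGZK W hmod hCM hred hW hS

end Strata

end Summit.BirchSwinnertonDyer.BirchSwinnertonDyer.Theorems.TwoAdicOffHabitat

end
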